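import Summits.BirchSwinnertonDyer.BirchSwinnertonDyer.Theorems.ByReductionTypeAtTwoMultUpperHalfTowerFiltAddv4
import Summits.BirchSwinnertonDyer.BirchSwinnertonDyer.Theorems.ByReductionTypeAtTwoTowerFiltrationExponentGap
import HarnessLib

/-!
# Route `ByReductionTypeAtTwo`, crux `MultUpperHalfAtTwo` (item stmt-BirchSwinnertonDyer-19922): the EXPONENT-gap doors — the
# σ-filtration doors re-keyed on the EXPONENT criterion `b + t < 2ⁿ` (seat bsd-2adic-mult-2 GEN 11, part 1 of 2 of the doors)

HONEST FRAMING (cell `bsd-2adic`, run/shared/lean/pub/bsd-2adic/, HUMAN RULINGS D-0036 / D-0054 / D-0074): research route;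
THEOREMS ONLY (no definition, no new named fact); nothing is booked; BSD is not proved by any of this. PARTITION: X5@2 mult (K4ᵐ,
RESIDUAL-MAP B1·O1; the 393 `E[2]`-irreducible rank-0 classes with no class file after mult-2 GEN 10 / tower-1 GEN 12) × p = 2 —
types-the-object-of (a sharper GAP CRITERION for the tower certificate, not a new local constant); closes none. bears_on: K4 (item 19922).

WHAT. The kernel files `…TowerFiltrationExponent{,Gap}` (this seat) prove: if `(conj_γ − id)^[b]` kills `Sel_{2^∞}(E/ℚ_n)[2]`
(`b` = the largest Jordan block of `σ − 1` on the layer's `2`-Selmer group; ENGINE A's `S2| SIGMA` vector: `s(b) = s(2ⁿ)`) and every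
local block is small — `C₂ ≤ 2^t` at the place over `2`, `C_ℓ^{2^{min(n, e_ℓ)}} ≤ 2^t` at each odd bad prime — and `b + t < 2ⁿ`,
then `O1.TowerGapAtTwo W`. GEN 9's window doors needed `b + c₂ + Σ_n < 2ⁿ` (the SUM of the local bits); these need
`b + max(c₂, max_ℓ block_ℓ) < 2ⁿ`. This file is tower-1's `…MultUpperHalfTowerFiltAddv4` §1 + `…FiltKernelAddv4` §1 with that
one change (the local interface — EIGHT per-prime disjuncts, `MultTowerAddv.pTorsion_localTowerKer_le_of_numeric_addv4` — is
untouched): `MultTowerExp.towerGapAtTwo_of_exponent_{numeric,nat,cert}_atTwo_addv4`. The binder-free habitats at `v ∣ 2` follow in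
`…MultUpperHalfTowerExpKernelAddv4`.

WHAT IS DISPLAYED, NOT PROVED: PRINT `h33g`/`hM`/`hA` (tree theorems `…_holds`), the displayed bound `h2` at `v ∣ 2`, the exponent
certificate `hstat` (kit certificate, ENGINE A + `S2| SIGMA`, evidence tier). ∀-LEVEL CONTENT: none.

References: R. Greenberg, LNM 1716 (1999), §3 pp. 85–94; L. Washington, *Introduction to Cyclotomic Fields*, §13; J. H. Silverman,
AEC III.§2 Ex. 3.7, VII.1, VII.5; ATAEC IV.9 Table 4.1.
-/

set_option autoImplicit false
-- the Theorems namespace of this sub repeats the summit name by design (D-0017 nested layout: Summit.<S>.<Sub>)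
set_option linter.dupNamespace false

noncomputable section

open scoped Classical MatrixGroups ModularForm

open NumberField IsDedekindDomain CongruenceSubgroup WeierstrassCurve Literature.NumberTheory.EllipticCurves
  Literature.NumberTheory.EllipticCurves.ModularForms
  Literature.NumberTheory.EllipticCurves.Greenberg1999
  Literature.NumberTheory.EllipticCurves.Rank1Residual
  Literature.NumberTheory.EllipticCurves.Rank1Residual.Typed
  Literature.NumberTheory.GaloisRepresentations
  Summit.BirchSwinnertonDyer.Rank1Residual.X5 Summit.BirchSwinnertonDyer.Rank1Residual.X5.O1
  Summit.BirchSwinnertonDyer.Rank1Residual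
  Summit.BirchSwinnertonDyer.BirchSwinnertonDyer.Theorems.KatoHalfPinch
  Summit.BirchSwinnertonDyer.BirchSwinnertonDyer.Theorems.MultTowerAddv
  Rat.HeightOneSpectrum

namespace Summit.BirchSwinnertonDyer.BirchSwinnertonDyer.Theorems.MultTowerExp

/-! ## §1 The exponent gap certificate with EIGHT disjuncts (numeric, prime-indexed and decidable forms) -/

section Gap

variable (W : WeierstrassCurve ℚ) [W.IsElliptic] [W.IsGloballyMinimal]

omit [W.IsGloballyMinimal] in
/-- **The EXPONENT GAP certificate with NUMERIC local constants, the constant at `2` a DATUM, EIGHT disjuncts.** `W/ℚ` with odd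
torsion order (ANY reduction type at `2`); ONE layer `n` and `b + t < 2ⁿ`; `S` a finite set of finite places off which every place is
odd and good; PRINT `h33g`, `hM`, `hA`; a displayed bound `h2` at the place(s) over `2` by `C₂`; numeric constants `C_v` at the odd
`v ∈ S` justified by ONE of eight disjuncts (`MultTowerAddv.pTorsion_localTowerKer_le_of_numeric_addv4`); the EXPONENT certificate
`(conj_γ − id)^[b] z = 0` on `Sel_{2^∞}(E/ℚ_n)[2]`; block bounds `(2 ∈ v ? C₂ : C_v)^{(2 ∈ v ? 1 : 2^{min(n, v₂(ℓ_v² − 1) − 3)})} ≤ 2^t`.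
Then `O1.TowerGapAtTwo W` (`TowerFiltration.towerGapAtTwo_of_exponent_localKernelBounds_sharp`).
[cite: GreenbergLNM1716, §3 Lemmas 3.3–3.5 (PDF pp. 86–90) and pp. 90–93] [cite: SilvermanATAEC1994, IV.9 Table 4.1] -/
theorem towerGapAtTwo_of_exponent_numeric_atTwo_addv4
    (h33g : lemma33_localTowerKerPrimary_eq_bot_of_good.{0})
    (hM : lemma33_localTowerKerPrimary_cyclic_of_multiplicative.{0})
    (hA : lemma33_natCard_localTowerKerPrimary_le_four_of_additive.{0})
    (htors : ¬ 2 ∣ W.torsionOrder) {n b t : ℕ} (hbt : b + t < 2 ^ n) (C₂ : ℕ)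
    (h2 : ∀ κ : ZpExtension ℚ 2, κ.IsCyclotomic → ∀ v : HeightOneSpectrum (𝓞 ℚ),
      ((2 : ℕ) : 𝓞 ℚ) ∈ v.asIdeal →
        Finite {x : W.localTowerKerPrimary κ (v.adicCompletion ℚ) n // 2 • x = 0} ∧
          Nat.card {x : W.localTowerKerPrimary κ (v.adicCompletion ℚ) n // 2 • x = 0} ≤ C₂)
    (S : Finset (HeightOneSpectrum (𝓞 ℚ)))
    (hS : ∀ v ∉ S, ((2 : ℕ) : 𝓞 ℚ) ∉ v.asIdeal ∧ W.HasGoodReductionAt v)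
    (C : HeightOneSpectrum (𝓞 ℚ) → ℕ)
    (hC : ∀ v ∈ S, ((2 : ℕ) : 𝓞 ℚ) ∉ v.asIdeal →
      4 ≤ C v ∨ (W.HasMultiplicativeReductionAt v ∧ 2 ≤ C v) ∨
        (W.HasMultiplicativeReductionAt v ∧ ¬ 2 ∣ W.ordMinimalDiscriminant v ∧ 1 ≤ C v) ∨
        (W.HasGoodReductionAt v ∧ 1 ≤ C v) ∨
        (W.HasAdditiveReductionAt v ∧ ¬ 2 ∣ (W.kodairaSymbolAt v).componentGroupOrder ∧ 1 ≤ C v) ∨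
        (W.HasAdditiveReductionAt v ∧ (∀ m, W.kodairaSymbolAt v ≠ .Istar m) ∧ 2 ≤ C v) ∨
        (W.HasAdditiveReductionAt v ∧ ¬ 2 ∣ W.ordMinimalDiscriminant v ∧ 2 ≤ C v) ∨
        (W.HasAdditiveReductionAt v ∧
          (∀ Q : localPoints W (v.adicCompletion ℚ),
            (∀ σ : Field.absoluteGaloisGroup (v.adicCompletion ℚ), σ • Q = Q) → 2 • Q = 0 → Q = 0) ∧ 1 ≤ C v))
    (hstat : ∀ (κ : ZpExtension ℚ 2) (γ : Field.absoluteGaloisGroup ℚ), κ.IsCyclotomic →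
      κ.IsTopGenerator γ → ∀ z : W.selmerLayer κ n, 2 • z = 0 →
        (⇑(W.conjH1 2 (κ.layerSubgroup n) γ -
          AddMonoidHom.id (W.subgroupH1 2 (κ.layerSubgroup n))))^[b]
          (z : W.subgroupH1 2 (κ.layerSubgroup n)) = 0)
    (hexp : ∀ v ∈ S, (if ((2 : ℕ) : 𝓞 ℚ) ∈ v.asIdeal then C₂ else C v) ^
        (if ((2 : ℕ) : 𝓞 ℚ) ∈ v.asIdeal then 1
          else 2 ^ min n (padicValNat 2 (natGenerator v ^ 2 - 1) - 3)) ≤ 2 ^ t) : TowerGapAtTwo W := by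
  refine TowerFiltration.towerGapAtTwo_of_exponent_localKernelBounds_sharp W htors hbt S
    (fun v ↦ if ((2 : ℕ) : 𝓞 ℚ) ∈ v.asIdeal then C₂ else C v) hstat
    (fun κ hκ v hv ↦ h33g ℚ W 2 κ hκ v (hS v hv).1 (hS v hv).2 n) (fun κ hκ v hv ↦ ?_) hexp
  by_cases h2v : ((2 : ℕ) : 𝓞 ℚ) ∈ v.asIdeal
  · rw [if_pos h2v]
    exact h2 κ hκ v h2v
  · rw [if_neg h2v]
    exact pTorsion_localTowerKer_le_of_numeric_addv4 W h33g hM hA κ hκ v h2v n (C v) (hC v hv h2v)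


/-- **The EXPONENT GAP certificate indexed by rational primes, the constant at `2` a DATUM, EIGHT disjuncts.** `P` a finite set of ODD
primes containing every odd prime of the minimal discriminant, `C : ℕ → ℕ` justified per `ℓ ∈ P` by one of eight disjuncts (as in
`MultTowerFilt.towerGapAtTwo_of_filtration_nat_atTwo_addv4`, proof verbatim up to the last step); block bounds `C₂ ≤ 2^t`,
`C_ℓ^{2^{min(n, v₂(ℓ² − 1) − 3)}} ≤ 2^t`; exponent certificate `hstat`; `b + t < 2ⁿ`.
[cite: GreenbergLNM1716, §3 Lemmas 3.3–3.5 (PDF pp. 86–90) and pp. 90–93] [cite: SilvermanAEC2009, VII.1 Prop. 1.3, VII.5.1] -/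
theorem towerGapAtTwo_of_exponent_nat_atTwo_addv4
    (h33g : lemma33_localTowerKerPrimary_eq_bot_of_good.{0})
    (hM : lemma33_localTowerKerPrimary_cyclic_of_multiplicative.{0})
    (hA : lemma33_natCard_localTowerKerPrimary_le_four_of_additive.{0})
    (htors : ¬ 2 ∣ W.torsionOrder) {n b t : ℕ} (hbt : b + t < 2 ^ n) (C₂ : ℕ)
    (h2 : ∀ κ : ZpExtension ℚ 2, κ.IsCyclotomic → ∀ v : HeightOneSpectrum (𝓞 ℚ),
      ((2 : ℕ) : 𝓞 ℚ) ∈ v.asIdeal →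
        Finite {x : W.localTowerKerPrimary κ (v.adicCompletion ℚ) n // 2 • x = 0} ∧
          Nat.card {x : W.localTowerKerPrimary κ (v.adicCompletion ℚ) n // 2 • x = 0} ≤ C₂)
    (P : Finset ℕ) (hP : ∀ ℓ ∈ P, ℓ.Prime ∧ ℓ ≠ 2)
    (hΔ : ∀ ℓ : ℕ, ℓ.Prime → ℓ ≠ 2 → (ℓ : ℤ) ∣ W.minimalDiscriminantInt → ℓ ∈ P)
    (C : ℕ → ℕ)
    (hC : ∀ (ℓ : ℕ) [Fact ℓ.Prime], ℓ ∈ P →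
      4 ≤ C ℓ ∨ (W.HasMultiplicativeReductionAtPrime ℓ ∧ 2 ≤ C ℓ) ∨
        (W.HasMultiplicativeReductionAtPrime ℓ ∧ ¬ 2 ∣ padicValInt ℓ W.minimalDiscriminantInt ∧
          1 ≤ C ℓ) ∨
        (¬ (ℓ : ℤ) ∣ W.minimalDiscriminantInt ∧ 1 ≤ C ℓ) ∨
        ((∃ k : ℕ, (ℓ : ℤ) ∣ (integralModelInt W).c₄ ∧ (ℓ : ℤ) ^ k ∣ W.minimalDiscriminantInt ∧
            ¬ (ℓ : ℤ) ^ (k + 1) ∣ W.minimalDiscriminantInt ∧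
            (k = 2 ∨ k = 4 ∨ k = 5 ∨ (7 ≤ k ∧ k ≠ 9 ∧ (ℓ : ℤ) ^ k ∣ (integralModelInt W).c₄ ^ 3))) ∧ 1 ≤ C ℓ) ∨
        ((∃ k : ℕ, (ℓ : ℤ) ∣ (integralModelInt W).c₄ ∧ (ℓ : ℤ) ^ k ∣ W.minimalDiscriminantInt ∧
            ¬ (ℓ : ℤ) ^ (k + 1) ∣ W.minimalDiscriminantInt ∧ 1 ≤ k ∧ k ≠ 6 ∧ (ℓ : ℤ) ^ k ∣ (integralModelInt W).c₄ ^ 3) ∧ 2 ≤ C ℓ) ∨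
        ((∃ k : ℕ, (ℓ : ℤ) ∣ (integralModelInt W).c₄ ∧ (ℓ : ℤ) ^ k ∣ W.minimalDiscriminantInt ∧
            ¬ (ℓ : ℤ) ^ (k + 1) ∣ W.minimalDiscriminantInt ∧ ¬ 2 ∣ k) ∧ 2 ≤ C ℓ) ∨
        (((ℓ : ℤ) ∣ (integralModelInt W).c₄ ∧ (ℓ : ℤ) ∣ W.minimalDiscriminantInt ∧
            ∃ k : ℕ, ∀ x : ZMod (ℓ ^ k), 4 * x ^ 3 + ((integralModelInt W).b₂ : ZMod (ℓ ^ k)) * x ^ 2 +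
              2 * ((integralModelInt W).b₄ : ZMod (ℓ ^ k)) * x + ((integralModelInt W).b₆ : ZMod (ℓ ^ k)) ≠ 0) ∧
          1 ≤ C ℓ))
    (hstat : ∀ (κ : ZpExtension ℚ 2) (γ : Field.absoluteGaloisGroup ℚ), κ.IsCyclotomic →
      κ.IsTopGenerator γ → ∀ z : W.selmerLayer κ n, 2 • z = 0 →
        (⇑(W.conjH1 2 (κ.layerSubgroup n) γ -
          AddMonoidHom.id (W.subgroupH1 2 (κ.layerSubgroup n))))^[b]
          (z : W.subgroupH1 2 (κ.layerSubgroup n)) = 0)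
    (hexp2 : C₂ ≤ 2 ^ t) (hexp : ∀ ℓ ∈ P, C ℓ ^ 2 ^ min n (padicValNat 2 (ℓ ^ 2 - 1) - 3) ≤ 2 ^ t) :
    TowerGapAtTwo W := by
  -- the places (exactly as in tower-1 part 8 / GEN 4 / GEN 8)
  let pl : ℕ → HeightOneSpectrum (𝓞 ℚ) := fun ℓ ↦
    if h : ℓ.Prime then (primesEquiv (R := 𝓞 ℚ)).symm ⟨ℓ, h⟩
      else (primesEquiv (R := 𝓞 ℚ)).symm ⟨2, Nat.prime_two⟩
  have hpl : ∀ {ℓ : ℕ}, ℓ.Prime → natGenerator (pl ℓ) = ℓ := fun {ℓ} h ↦ by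
    simp only [pl, dif_pos h]
    exact congrArg Subtype.val ((primesEquiv (R := 𝓞 ℚ)).apply_symm_apply ⟨ℓ, h⟩)
  have hpl_inj : Set.InjOn pl P := by
    intro ℓ hℓ ℓ' hℓ' h
    have := congrArg natGenerator h
    rwa [hpl (hP ℓ hℓ).1, hpl (hP ℓ' hℓ').1] at this
  let v₂ : HeightOneSpectrum (𝓞 ℚ) := pl 2
  have hv₂ : natGenerator v₂ = 2 := hpl Nat.prime_two
  have h2v₂ : ((2 : ℕ) : 𝓞 ℚ) ∈ v₂.asIdeal := (natCast_prime_mem_asIdeal_iff v₂ Nat.prime_two).mpr hv₂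
  have hv₂_notMem : v₂ ∉ P.image pl := by
    intro h
    obtain ⟨ℓ, hℓ, hℓeq⟩ := Finset.mem_image.mp h
    have := congrArg natGenerator hℓeq
    rw [hpl (hP ℓ hℓ).1, hv₂] at this
    exact (hP ℓ hℓ).2 this
  -- odd places in the image
  have hodd : ∀ {ℓ : ℕ}, ℓ ∈ P → ((2 : ℕ) : 𝓞 ℚ) ∉ (pl ℓ).asIdeal := fun {ℓ} hℓ h ↦ by
    rw [natCast_prime_mem_asIdeal_iff _ Nat.prime_two, hpl (hP ℓ hℓ).1] at h
    exact (hP ℓ hℓ).2 h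
  let S : Finset (HeightOneSpectrum (𝓞 ℚ)) := insert v₂ (P.image pl)
  let Cv : HeightOneSpectrum (𝓞 ℚ) → ℕ := fun v ↦ C (natGenerator v)
  refine towerGapAtTwo_of_exponent_numeric_atTwo_addv4 W h33g hM hA htors hbt C₂ h2 S ?_ Cv ?_ hstat ?_
  · -- `hS`: off `S` every place is odd and good
    intro v hv
    have hgen := prime_natGenerator v
    haveI : Fact (natGenerator v).Prime := ⟨hgen⟩
    have hvpl : pl (natGenerator v) = v := by
      simp only [pl, dif_pos hgen]
      exact (primesEquiv (R := 𝓞 ℚ)).symm_apply_apply v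
    have hne2 : natGenerator v ≠ 2 := by
      intro h
      apply hv
      rw [Finset.mem_insert]
      left
      rw [← hvpl]
      simp only [v₂, h]
    have hnotP : natGenerator v ∉ P := by
      intro h
      exact hv (Finset.mem_insert_of_mem (Finset.mem_image.mpr ⟨_, h, hvpl⟩))
    refine ⟨fun h ↦ hne2 ((natCast_prime_mem_asIdeal_iff v Nat.prime_two).mp h), ?_⟩
    have hndvd : ¬ ((natGenerator v : ℕ) : ℤ) ∣ W.minimalDiscriminantInt :=
      fun h ↦ hnotP (hΔ _ hgen hne2 h)
    exact (hasGoodReductionAtPrime_iff_hasGoodReductionAt_ringOfIntegers (v := v) W).mp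
      (hasGoodReductionAtPrime_of_not_dvd W (natGenerator v) hndvd)
  · -- `hC`: the numeric local constants at the odd places of `S`
    intro v hv h2
    rcases Finset.mem_insert.mp hv with rfl | hv'
    · exact absurd h2v₂ h2
    obtain ⟨ℓ, hℓP, rfl⟩ := Finset.mem_image.mp hv'
    have hℓ := (hP ℓ hℓP).1
    haveI : Fact ℓ.Prime := ⟨hℓ⟩
    have hgen : natGenerator (pl ℓ) = ℓ := hpl hℓ
    haveI : Fact (Nat.Prime ((primesEquiv (pl ℓ) : Nat.Primes) : ℕ)) := ⟨(primesEquiv (pl ℓ)).2⟩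
    have hpe : ((primesEquiv (pl ℓ) : Nat.Primes) : ℕ) = ℓ := hgen
    have hCv : Cv (pl ℓ) = C ℓ := by simp only [Cv, hgen]
    rw [hCv]
    rcases hC ℓ hℓP with h4 | ⟨hm, h2C⟩ | ⟨hm, hord, h1⟩ | ⟨hg, h1⟩ | ⟨⟨k, hc₄, hk, hk', hcases⟩, h1⟩ |
        ⟨⟨k, hc₄, hk, hk', hk1, hk6, hj⟩, h2C⟩ | ⟨⟨k, hc₄, hk, hk', hko⟩, h2C⟩ | ⟨⟨hc₄, hdΔ, k, hcert⟩, h1⟩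
    · exact Or.inl h4
    · refine Or.inr (Or.inl ⟨?_, h2C⟩)
      exact (hasMultiplicativeReductionAtPrime_iff_hasMultiplicativeReductionAt_ringOfIntegers
        (W := W) (pl ℓ)).mp ((hasMultiplicativeReductionAtPrime_congr W hpe).mpr hm)
    · refine Or.inr (Or.inr (Or.inl ⟨?_, ?_, h1⟩))
      · exact (hasMultiplicativeReductionAtPrime_iff_hasMultiplicativeReductionAt_ringOfIntegers
          (W := W) (pl ℓ)).mp ((hasMultiplicativeReductionAtPrime_congr W hpe).mpr hm)
      · rwa [LocalTorsionMult.ordMinimalDiscriminant_eq_padicValInt W (pl ℓ) hpe]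
    · refine Or.inr (Or.inr (Or.inr (Or.inl ⟨?_, h1⟩)))
      exact (hasGoodReductionAtPrime_iff_hasGoodReductionAt_ringOfIntegers (v := pl ℓ) W).mp
        ((hasGoodReductionAtPrime_congr W hpe).mpr (hasGoodReductionAtPrime_of_not_dvd W ℓ hg))
    · refine Or.inr (Or.inr (Or.inr (Or.inr (Or.inl ⟨?_, ?_, h1⟩))))
      · exact (hasAdditiveReductionAt_and_not_two_dvd_componentGroupOrder_of_cert W (pl ℓ) hpe (hP ℓ hℓP).2
          hc₄ hk hk' hcases).1
      · exact (hasAdditiveReductionAt_and_not_two_dvd_componentGroupOrder_of_cert W (pl ℓ) hpe (hP ℓ hℓP).2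
          hc₄ hk hk' hcases).2
    · refine Or.inr (Or.inr (Or.inr (Or.inr (Or.inr (Or.inl ⟨?_, ?_, h2C⟩)))))
      · exact (hasAdditiveReductionAt_and_ne_Istar_of_cert W (pl ℓ) hpe (hP ℓ hℓP).2 hc₄ hk hk' hk1 hk6 hj).1
      · exact (hasAdditiveReductionAt_and_ne_Istar_of_cert W (pl ℓ) hpe (hP ℓ hℓP).2 hc₄ hk hk' hk1 hk6 hj).2
    · refine Or.inr (Or.inr (Or.inr (Or.inr (Or.inr (Or.inr (Or.inl ⟨?_, ?_, h2C⟩))))))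
      · exact (hasAdditiveReductionAt_and_odd_ord_of_cert W (pl ℓ) hpe hc₄ hk hk' hko).1
      · rw [LocalTorsionMult.ordMinimalDiscriminant_eq_padicValInt W (pl ℓ) hpe, padicValInt_eq_of_dvd_of_not_dvd hk hk']
        exact hko
    · refine Or.inr (Or.inr (Or.inr (Or.inr (Or.inr (Or.inr (Or.inr ⟨?_, ?_, h1⟩))))))
      · exact W.hasAdditiveReductionAt_of_dvd_of_dvd (pl ℓ) (by rw [hpe]; exact hdΔ) (by rw [hpe]; exact hc₄)
      · exact TowerAddvZ.noTwoTorsion_of_cubic_cert W (pl ℓ) hpe (hP ℓ hℓP).2 (TowerAddvZ.b_eq_integralModelInt W) hcert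
  · -- the block bounds, re-indexed by primes
    intro v hv
    rcases Finset.mem_insert.mp hv with rfl | hv'
    · rw [if_pos h2v₂, if_pos h2v₂, pow_one]
      exact hexp2
    · obtain ⟨ℓ, hℓP, rfl⟩ := Finset.mem_image.mp hv'
      rw [if_neg (hodd hℓP), if_neg (hodd hℓP)]
      simp only [Cv, hpl (hP ℓ hℓP).1]
      exact hexp ℓ hℓP




/-- **The EXPONENT GAP certificate, every kernel-side datum decidable, the constant at `2` a DATUM, EIGHT disjuncts** (`C e k : ℕ → ℕ`:
the per-prime constant, the splitting bound `¬ 2^{e_ℓ+4} ∣ ℓ² − 1`, the exponent / certificate depth; as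
`MultTowerFilt.towerGapAtTwo_of_filtration_cert_atTwo_addv4`, proof verbatim, with the window data replaced by the exponent certificate
`hstat` and the block bounds `C₂ ≤ 2^t`, `C_ℓ^{2^{min(n, e_ℓ)}} ≤ 2^t`, `b + t < 2ⁿ`).
[cite: GreenbergLNM1716, §3 Lemmas 3.3–3.5 (PDF pp. 86–90) and pp. 90–93] [cite: SilvermanATAEC1994, IV.9 Table 4.1] -/
theorem towerGapAtTwo_of_exponent_cert_atTwo_addv4
    (h33g : lemma33_localTowerKerPrimary_eq_bot_of_good.{0})
    (hM : lemma33_localTowerKerPrimary_cyclic_of_multiplicative.{0})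
    (hA : lemma33_natCard_localTowerKerPrimary_le_four_of_additive.{0})
    (htors : ¬ 2 ∣ W.torsionOrder) {n b t : ℕ} (hbt : b + t < 2 ^ n) (C₂ : ℕ)
    (h2 : ∀ κ : ZpExtension ℚ 2, κ.IsCyclotomic → ∀ v : HeightOneSpectrum (𝓞 ℚ),
      ((2 : ℕ) : 𝓞 ℚ) ∈ v.asIdeal →
        Finite {x : W.localTowerKerPrimary κ (v.adicCompletion ℚ) n // 2 • x = 0} ∧
          Nat.card {x : W.localTowerKerPrimary κ (v.adicCompletion ℚ) n // 2 • x = 0} ≤ C₂)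
    (P : Finset ℕ) (hP : ∀ ℓ ∈ P, ℓ.Prime ∧ ℓ ≠ 2)
    (hΔ : ∀ ℓ : ℕ, ℓ.Prime → ℓ ≠ 2 → (ℓ : ℤ) ∣ W.minimalDiscriminantInt → ℓ ∈ P)
    (C e k : ℕ → ℕ) (he : ∀ ℓ ∈ P, ¬ 2 ^ (e ℓ + 4) ∣ ℓ ^ 2 - 1)
    (hC : ∀ (ℓ : ℕ) [Fact ℓ.Prime], ℓ ∈ P →
      4 ≤ C ℓ ∨ (W.HasMultiplicativeReductionAtPrime ℓ ∧ 2 ≤ C ℓ) ∨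
        (W.HasMultiplicativeReductionAtPrime ℓ ∧ (ℓ : ℤ) ^ k ℓ ∣ W.minimalDiscriminantInt ∧
          ¬ (ℓ : ℤ) ^ (k ℓ + 1) ∣ W.minimalDiscriminantInt ∧ ¬ 2 ∣ k ℓ ∧ 1 ≤ C ℓ) ∨
        (¬ (ℓ : ℤ) ∣ W.minimalDiscriminantInt ∧ 1 ≤ C ℓ) ∨
        ((ℓ : ℤ) ∣ (integralModelInt W).c₄ ∧ (ℓ : ℤ) ^ k ℓ ∣ W.minimalDiscriminantInt ∧
          ¬ (ℓ : ℤ) ^ (k ℓ + 1) ∣ W.minimalDiscriminantInt ∧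
          (k ℓ = 2 ∨ k ℓ = 4 ∨ k ℓ = 5 ∨ (7 ≤ k ℓ ∧ k ℓ ≠ 9 ∧ (ℓ : ℤ) ^ k ℓ ∣ (integralModelInt W).c₄ ^ 3)) ∧ 1 ≤ C ℓ) ∨
        ((ℓ : ℤ) ∣ (integralModelInt W).c₄ ∧ (ℓ : ℤ) ^ k ℓ ∣ W.minimalDiscriminantInt ∧
          ¬ (ℓ : ℤ) ^ (k ℓ + 1) ∣ W.minimalDiscriminantInt ∧ 1 ≤ k ℓ ∧ k ℓ ≠ 6 ∧
          (ℓ : ℤ) ^ k ℓ ∣ (integralModelInt W).c₄ ^ 3 ∧ 2 ≤ C ℓ) ∨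
        ((ℓ : ℤ) ∣ (integralModelInt W).c₄ ∧ (ℓ : ℤ) ^ k ℓ ∣ W.minimalDiscriminantInt ∧
          ¬ (ℓ : ℤ) ^ (k ℓ + 1) ∣ W.minimalDiscriminantInt ∧ ¬ 2 ∣ k ℓ ∧ 2 ≤ C ℓ) ∨
        ((ℓ : ℤ) ∣ (integralModelInt W).c₄ ∧ (ℓ : ℤ) ∣ W.minimalDiscriminantInt ∧
          (∀ x : ZMod (ℓ ^ k ℓ), 4 * x ^ 3 + ((integralModelInt W).b₂ : ZMod (ℓ ^ k ℓ)) * x ^ 2 +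
            2 * ((integralModelInt W).b₄ : ZMod (ℓ ^ k ℓ)) * x + ((integralModelInt W).b₆ : ZMod (ℓ ^ k ℓ)) ≠ 0) ∧
          1 ≤ C ℓ))
    (hstat : ∀ (κ : ZpExtension ℚ 2) (γ : Field.absoluteGaloisGroup ℚ), κ.IsCyclotomic →
      κ.IsTopGenerator γ → ∀ z : W.selmerLayer κ n, 2 • z = 0 →
        (⇑(W.conjH1 2 (κ.layerSubgroup n) γ -
          AddMonoidHom.id (W.subgroupH1 2 (κ.layerSubgroup n))))^[b]
          (z : W.subgroupH1 2 (κ.layerSubgroup n)) = 0)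
    (hexp2 : C₂ ≤ 2 ^ t) (hexp : ∀ ℓ ∈ P, C ℓ ^ 2 ^ min n (e ℓ) ≤ 2 ^ t) :
    TowerGapAtTwo W := by
  -- `1 ≤ C ℓ` on `P`
  have hC1 : ∀ ℓ ∈ P, 1 ≤ C ℓ := by
    intro ℓ hℓ
    haveI : Fact ℓ.Prime := ⟨(hP ℓ hℓ).1⟩
    rcases hC ℓ hℓ with h | ⟨-, h⟩ | ⟨-, -, -, -, h⟩ | ⟨-, h⟩ | ⟨-, -, -, -, h⟩ | ⟨-, -, -, -, -, -, h⟩ |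
        ⟨-, -, -, -, h⟩ | ⟨-, -, -, h⟩ <;> omega
  refine towerGapAtTwo_of_exponent_nat_atTwo_addv4 W h33g hM hA htors hbt C₂ h2 P hP hΔ C
    (fun ℓ _ hℓ ↦ ?_) hstat hexp2 (fun ℓ hℓ ↦ le_trans ?_ (hexp ℓ hℓ))
  · rcases hC ℓ hℓ with h | h | ⟨hm, h1, h2', hodd, hC'⟩ | h | ⟨hc₄, h1, h2', hcases, hC'⟩ |
        ⟨hc₄, h1, h2', hk1, hk6, hj, hC'⟩ | ⟨hc₄, h1, h2', hko, hC'⟩ | ⟨hc₄, hdΔ, hcert, hC'⟩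
    · exact Or.inl h
    · exact Or.inr (Or.inl h)
    · refine Or.inr (Or.inr (Or.inl ⟨hm, ?_, hC'⟩))
      rwa [padicValInt_eq_of_dvd_of_not_dvd h1 h2']
    · exact Or.inr (Or.inr (Or.inr (Or.inl h)))
    · exact Or.inr (Or.inr (Or.inr (Or.inr (Or.inl ⟨⟨k ℓ, hc₄, h1, h2', hcases⟩, hC'⟩))))
    · exact Or.inr (Or.inr (Or.inr (Or.inr (Or.inr (Or.inl ⟨⟨k ℓ, hc₄, h1, h2', hk1, hk6, hj⟩, hC'⟩)))))
    · exact Or.inr (Or.inr (Or.inr (Or.inr (Or.inr (Or.inr (Or.inl ⟨⟨k ℓ, hc₄, h1, h2', hko⟩, hC'⟩))))))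
    · exact Or.inr (Or.inr (Or.inr (Or.inr (Or.inr (Or.inr (Or.inr ⟨⟨hc₄, hdΔ, k ℓ, hcert⟩, hC'⟩))))))
  · refine Nat.pow_le_pow_right (hC1 ℓ hℓ) (Nat.pow_le_pow_right (by norm_num) ?_)
    have hℓ2 : ℓ ^ 2 - 1 ≠ 0 := by
      have h3 : 2 ≤ ℓ := (hP ℓ hℓ).1.two_le
      have : 4 ≤ ℓ ^ 2 := by nlinarith
      omega
    exact min_le_min_left _ (padicValNat_sq_sub_one_sub_three_le hℓ2 (he ℓ hℓ))


end Gap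

end Summit.BirchSwinnertonDyer.BirchSwinnertonDyer.Theorems.MultTowerExp

end
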